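import Literature.Analysis.FluidPDE.Tao2016AveragedNS.SplitCascadeAsymEnergy
import Literature.Analysis.ODE.VectorLinearComparison
import HarnessLib

/-!
# The split Prop. 6.5: Grönwall for the asymmetry triple at one scale with time-dependent majorants

T. Tao, *Finite time blowup for an averaged three-dimensional Navier–Stokes equation*,
arXiv:1402.0290v3, §5.5, §6.4 Prop. 6.5; Grönwall [`HairerNorsettWanner1993`, §I.10].
HONEST FRAMING: statements about the SPLIT cascade model system; nothing here proves the split
Prop. 6.5 and nothing here concerns the true Navier–Stokes equations.

The energy inequality of `SplitCascadeAsymEnergy.lean` fed into the Euclidean-norm comparison lemma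
`Literature.Analysis.ODE.sqrt_sum_sq_le_linearComparison`: on any window `[t₁, t₂]`, `t₁ ≥ τ₀`, with
continuous majorants `β ≥ rate_k`, `R ≥ √3·C₁(1+ε₀)^{2k-n₀/2}Ẽ_k^{1/2}`,
`(Σ_i Z̃_{i,k}(t)²)^{1/2} ≤ exp(∫_{t₁}^t β)((Σ_i Z̃_{i,k}(t₁)²)^{1/2} + ∫_{t₁}^t R)`.
Over the past of the fresh shell the user takes `β, R` proportional to the (geometrically decaying)
energy envelopes of the shells `k, k+1`, so that `∫β` is bounded uniformly in `N` and `∫R` is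
`n₀`-small — the whole-past asymmetry smallness needed by (6.109)♯.

## References

* T. Tao, arXiv:1402.0290v3, §5.5, §6.4. [`Tao2016AveragedNS`]
* E. Hairer, S. P. Nørsett, G. Wanner, *Solving ODE I*, §I.10. [`HairerNorsettWanner1993`]
-/

noncomputable section

open Set MeasureTheory intervalIntegral

namespace Literature.Analysis.FluidPDE

namespace Tao2016AveragedNS

open Literature.Analysis.ODE

section AsymGronwall

variable {γ ε₀ K ε C₁ C₂ C₃ : ℝ} {n₀ N : ℤ} {ηp : ℤ → ℝ} {βp : ℕ → ℝ} {τ : ℤ → ℝ}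
  {Y : Fin 4 → ℤ → ℝ → ℝ} {W : Fin 3 → ℤ → ℝ → ℝ} {F : ℤ → ℝ → ℝ}

/-- **Grönwall for the asymmetry triple at scale `k` with majorants.** On `[t₁, t₂]` (`t₁ ≥ τ₀`),
if continuous `β ≥ 0` dominates the rate
`(1+ε₀)^{5k/2}(ε|b̃_k| + ε²e^{-K¹⁰}|c̃_k| + ε⁻²(|ã_k|+|d̃_k|) + ε⁻¹K¹⁰|b̃_k| + (1+ε₀)^{5/2}K|ã_{k+1}|)` and
continuous `R ≥ 0` dominates `√3·C₁(1+ε₀)^{2k-n₀/2}Ẽ_k^{1/2}` on `[t₁, t₂)`, then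
`(Σ_i Z̃_{i,k}(t)²)^{1/2} ≤ e^{∫_{t₁}^t β}((Σ_i Z̃_{i,k}(t₁)²)^{1/2} + ∫_{t₁}^t R)` for `t ∈ [t₁, t₂]`.
[cite: Tao2016AveragedNS, §5.5, §6.4 Prop. 6.5] -/
theorem RescaledSplitHypotheses.sqrt_asym_sq_le
    (h : RescaledSplitHypotheses γ ε₀ K ε C₁ C₂ C₃ n₀ N ηp βp τ Y W F) (hε₀ : -1 < ε₀)
    (hε : 0 < ε) (hK : 0 ≤ K) (k : ℤ) {t₁ t₂ : ℝ} (ht₁ : τ (n₀ - N) ≤ t₁) {β R : ℝ → ℝ}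
    (hβc : ContinuousOn β (Icc t₁ t₂)) (hβ0 : ∀ t ∈ Icc t₁ t₂, 0 ≤ β t)
    (hβ : ∀ t ∈ Ico t₁ t₂, (1 + ε₀) ^ ((5 : ℝ) * k / 2) * (ε * |Y 1 k t| +
      ε ^ 2 * Real.exp (-K ^ 10) * |Y 2 k t| + (ε ^ 2)⁻¹ * (|Y 0 k t| + |Y 3 k t|) +
      ε⁻¹ * K ^ 10 * |Y 1 k t| + (1 + ε₀) ^ ((5 : ℝ) / 2) * K * |Y 0 (k + 1) t|) ≤ β t)
    (hRc : ContinuousOn R (Icc t₁ t₂)) (hR0 : ∀ t ∈ Icc t₁ t₂, 0 ≤ R t)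
    (hR : ∀ t ∈ Ico t₁ t₂,
      Real.sqrt 3 * (C₁ * (1 + ε₀) ^ ((2 : ℝ) * k - n₀ / 2) * Real.sqrt (F k t)) ≤ R t)
    {t : ℝ} (ht : t ∈ Icc t₁ t₂) :
    Real.sqrt (∑ i, W i k t ^ 2) ≤
      Real.exp (∫ s in t₁..t, β s) * (Real.sqrt (∑ i, W i k t₁ ^ 2) + ∫ s in t₁..t, R s) := by
  refine sqrt_sum_sq_le_linearComparison (w := fun i => W i k)
    (w' := fun i s => derivWithin (W i k) (Ici (τ (n₀ - N))) s)
    (fun i => h.continuousOn_W i k ht₁) (fun i s hs => h.hasDeriv_W i k (ht₁.trans hs.1))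
    hβc hβ0 hRc hR0 (fun s hs => ?_) ht
  have hs1 : τ (n₀ - N) ≤ s := ht₁.trans hs.1
  have hen := h.asym_energy_ineq hε₀ hε hK k hs1
  have hS0 : 0 ≤ ∑ i, W i k s ^ 2 := Finset.sum_nonneg fun i _ => sq_nonneg _
  have hsq0 : 0 ≤ Real.sqrt (∑ i, W i k s ^ 2) := Real.sqrt_nonneg _
  have h1 := mul_le_mul_of_nonneg_right (hβ s hs) hS0
  have h2 := mul_le_mul_of_nonneg_right (hR s hs) hsq0
  simpa using hen.trans (by linarith)

end AsymGronwall

end Tao2016AveragedNS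

end Literature.Analysis.FluidPDE
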